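/-
Copyright: statement-level skeleton of a published paper (lit-balaban cell, Phase-2 proof seat p25, gen 15). No proof
claims beyond what the kernel checks below.
-/
import Literature.MathematicalPhysics.QuantumFieldTheory.BalabanImbrieJaffe1984to88.BIJ88VertexComponents311
import Literature.MathematicalPhysics.QuantumFieldTheory.BalabanImbrieJaffe1984to88.BIJ88WickDerivatives305

/-!
# `BalabanImbrieJaffe1984to88.BIJ88VertexComponentsExpansion311` — T. Bałaban, J. Imbrie, A. Jaffe, *Effective action and
cluster properties of the abelian Higgs model*, Commun. Math. Phys. **114** (1988) 257–315 [BalabanImbrieJaffe1988],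
§5.14 p. 311–312 [PDF 55–56] *"We integrate by parts in the Gaussian expectation (5.14.1). … We stop integrating by parts
fields in complete components of X. After sufficiently many integrations by parts, all components of X will be complete.
… Then the result of the integration by parts is ⟨Π_{σ_i}F^{m̄}_{k,loc}(X_{σ_i})⟩ = Σ Π_c F^L_{k+1,loc}(X_c)
⟨Π_r F_{k,rem}(X_r)⟩ … By performing sufficiently many integrations by parts, we have arranged for enough small factors
to beat these large factors in the remainder terms"* — **THE IDENTITY OF THE COMPONENT EXPANSION AND ITS COEFFICIENT
BOUND**: for the expansion `cterms` of the sibling `BIJ88VertexComponents311` (print's stopping rule per component),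
NOTHING IS LOST — the Gaussian integral of the product of the observables' legs against `χe^{−V}` equals the sum over
the terms of coefficient times the integral of the components' pending legs against `(Π_{z∈dirs}∂_z)χ · e^{−V}`
(`cexpansion`, `cexpansion_init`) — and EVERY DIFFERENTIATED-DOWN VERTEX CONTRIBUTES ONE COUPLING CONSTANT
(`ccoef_bound`: `|coef| ≤ (max B 1)^{pot}·c_M^{nv}`, `nv = Σ_components nv`), so that a remainder component with `≥ m̄+1`
vertices carries `c_M^{m̄+1}` and one with a `χ′` carries a derivative of the cutoff under the integral.

statement-level skeleton of published theorems with citation tags; proofs where landed; nothing here is a claim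
about the Yang–Mills mass gap

PDF held: `paper:balaban1988-cmp114-bij-abelian-higgs-effective-action` (journal page = PDF page + 256); p. 311–312 =
PDF 55–56.

CITATION HEADER (lean-in-tree rule).  lit-balaban cell (HOME `run/shared/lean/pub/lit-balaban/`), Phase 2, seat p25
gen 15; row **C2.Claim@312** of `HOME/lit-balaban-r16/ROWS-C2-part2.md` (owner r16, referee ref-5; head untouched —
flip-path item (β) for all components, and the vertex small factor of item (γ) per term).  USED BY NAME, nothing
restated: the sibling `BIJ88VertexComponents311` (same seat and generation), `BIJ88VertexIbp311.{lmono, vexp, lmono_append,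
ibp_step}`, p25 gen 14's `BIJ88WickDerivatives305.{dlist, dlist_nil, dlist_cons}`, `B2Eq228Conditioning.{weight, source}`.

## What is proved (0 `sorry`, standard axioms, no new `Prop` facts; definitions with bodies: `gint`, `canon`, `cval`)

* `lmono_perm`/`gint_perm` (order of legs irrelevant), `dlist_append_singleton` (`(Π_{D++[z]}∂) = ∂_z∘(Π_D ∂)`),
  **`gint_cons`** (`ibp_step` against `(Π_D∂)χ`: pair | source | `χ′` = one more direction | vertex), the splitting
  lemmas `sum_range_append` / `sum_range_flatMap` (the pairing alternatives of the head leg sorted by the component of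
  the partner leg), `cval`, `sum_cval_scale/push/scale_bump`;
* **`cexpansion`** — THE IDENTITY for every state (complete `done`, arbitrary `todo`) and every list `D` of earlier
  `χ′`-directions: `gint (canon done todo) D = Σ_{t ∈ cterms done todo} coef_t · gint (legs of t's components) (D ++ dirs_t)`
  (strong induction on the potential; at each node `gint_cons` and the six groups of `cterms` matched, the partner-leg
  sum split by component, states identified up to the order of legs); **`cexpansion_init`** (from the observables:
  `∫Π_{all legs}Φ·χe^{−V}dμ = Σ_t coef_t ∫Π_{pending}Φ·(Π_{dirs}∂)χ·e^{−V}dμ`);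
* **`ccoef_bound`** — `|coef_t| ≤ (max B 1)^{pot done todo} · c_M^{nv_t}` under bracket bounds on a direction set
  containing all legs.
HONEST SCOPE: as in the sibling (contraction-graph components, one covariance, fixed order, no resummation into
`Π_c F^L(X_c)`, no estimates beyond the coefficient count); the cutoff hypotheses are `(Π_D∂)χ ∈ C¹` with
`((Π_D∂)χ)e^{−V}` bounded for every `D` (e.g. `χ` smooth with compact support).  NOT summit progress; NOT continuum; NOT
Clay.  Imports `BIJ88VertexComponents311` and `BIJ88WickDerivatives305`; modifies nothing.
-/

noncomputable section

namespace Literature.MathematicalPhysics.QuantumFieldTheory.BalabanImbrieJaffe1984to88.BIJ88VertexComponentsExpansion311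

open MeasureTheory Matrix Finset
open scoped BigOperators
open Literature.MathematicalPhysics.QuantumFieldTheory.Balaban1983to89
open B2Eq228Conditioning (weight source)
open BIJ88VertexIbp311 (lmono vexp)
open BIJ88VertexComponents311

variable {S : Type} [Fintype S] {ι : Type} [Fintype ι] [DecidableEq S]

/-! ## §4  The identity for the component expansion -/

section Identity

open BIJ88WickDerivatives305 (dlist dlist_nil dlist_cons)
open BIJ88VertexIbp311 (lmono_nil lmono_cons lmono_append ibp_step)

omit [DecidableEq S] in
/-- Monomials do not depend on the order of the legs. [folklore] -/
private theorem lmono_perm {P P' : List (S → ℝ)} (h : P.Perm P') (φ : S → ℝ) : lmono P φ = lmono P' φ := by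
  unfold lmono
  exact (h.map _).prod_eq

omit [Fintype S] [DecidableEq S] in
/-- One more derivative at the end of the list: `dlist (D ++ [z]) H = ∂_z (dlist D H)`. [folklore] -/
private theorem dlist_append_singleton : ∀ (D : List (S → ℝ)) (H : (S → ℝ) → ℝ) (z : S → ℝ),
    dlist (D ++ [z]) H = fun φ => fderiv ℝ (dlist D H) φ z
  | [], _, _ => rfl
  | a :: D, H, z => by
    rw [List.cons_append, dlist_cons, dlist_cons, dlist_append_singleton D _ z]

variable (A : Matrix S S ℝ) (f : S → ℝ) (χ : (S → ℝ) → ℝ) (c : ι → ℝ) (legs : ι → List (S → ℝ))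

/-- **The Gaussian integral of a monomial against `(Π_{z∈D}∂_z)χ · e^{−V}`** — the value of a state / of a term of the
component expansion. [cite: BalabanImbrieJaffe1988, §5.14 p.311–312] -/
def gint (P D : List (S → ℝ)) : ℝ :=
  ∫ φ : S → ℝ, lmono P φ * (dlist D χ φ * vexp c legs φ) * (weight A φ * source f φ)

omit [DecidableEq S] in
/-- `gint` does not depend on the order of the legs. [folklore] -/
private theorem gint_perm {P P' : List (S → ℝ)} (h : P.Perm P') (D : List (S → ℝ)) :
    gint A f χ c legs P D = gint A f χ c legs P' D := by
  unfold gint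
  exact integral_congr_ae (Filter.Eventually.of_forall fun φ => by simp only [lmono_perm h φ])

/-- The pending legs of a state, head component first, complete components last. [cite: BalabanImbrieJaffe1988, §5.14 p.311] -/
def canon (done todo : List (Grp S)) : List (S → ℝ) := todo.flatMap Grp.pend ++ done.flatMap Grp.pend

omit [Fintype S] [DecidableEq S] [Fintype ι] in
/-- **Splitting the sum over the legs of `P ++ Q`.** [folklore] -/
private theorem sum_range_append {X : Type} (P Q : List X) (d : X) (F : X → List X → ℝ) :
    ∑ i ∈ range (P ++ Q).length, F ((P ++ Q).getD i d) ((P ++ Q).eraseIdx i)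
      = (∑ i ∈ range P.length, F (P.getD i d) (P.eraseIdx i ++ Q))
        + ∑ j ∈ range Q.length, F (Q.getD j d) (P ++ Q.eraseIdx j) := by
  rw [List.length_append, Finset.sum_range_add]
  congr 1
  · refine sum_congr rfl fun i hi => ?_
    have hi' : i < P.length := mem_range.1 hi
    rw [List.getD_append _ _ _ _ hi', List.eraseIdx_append_of_lt_length hi']
  · refine sum_congr rfl fun j _ => ?_
    rw [List.getD_append_right _ _ _ _ (Nat.le_add_right _ _), Nat.add_sub_cancel_left,
      List.eraseIdx_append_of_length_le (Nat.le_add_right _ _), Nat.add_sub_cancel_left]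

omit [Fintype S] [DecidableEq S] [Fintype ι] in
/-- **Splitting the sum over the legs of a list of components** into the components and their legs, for a summand that
does not depend on the order of the remaining legs. [folklore] -/
private theorem sum_range_flatMap (F : (S → ℝ) → List (S → ℝ) → ℝ)
    (hF : ∀ x {P P' : List (S → ℝ)}, P.Perm P' → F x P = F x P') :
    ∀ (gs : List (Grp S)) (W : List (S → ℝ)),
      ∑ j ∈ range (gs.flatMap Grp.pend).length,
          F ((gs.flatMap Grp.pend).getD j 0) ((gs.flatMap Grp.pend).eraseIdx j ++ W)
        = ∑ k ∈ range gs.length, ∑ j ∈ range (gs.getD k default).pend.length,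
            F ((gs.getD k default).pend.getD j 0)
              ((gs.getD k default).pend.eraseIdx j ++ (gs.eraseIdx k).flatMap Grp.pend ++ W)
  | [], W => by simp
  | h :: gs, W => by
    have hsplit := sum_range_append h.pend (gs.flatMap Grp.pend) 0 (fun x P => F x (P ++ W))
    rw [List.flatMap_cons, hsplit, List.length_cons, Finset.sum_range_succ']
    simp only [List.getD_cons_zero, List.getD_cons_succ, List.eraseIdx_cons_zero, List.eraseIdx_cons_succ,
      List.flatMap_cons]
    rw [add_comm]
    congr 1
    -- the legs of the later components: move `h.pend` past them and use the induction hypothesis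
    have e : ∀ j ∈ range (gs.flatMap Grp.pend).length,
        F ((gs.flatMap Grp.pend).getD j 0) (h.pend ++ (gs.flatMap Grp.pend).eraseIdx j ++ W)
          = F ((gs.flatMap Grp.pend).getD j 0) ((gs.flatMap Grp.pend).eraseIdx j ++ (h.pend ++ W)) :=
      fun j _ => hF _ (by
        rw [List.append_assoc]
        exact List.perm_append_comm_assoc _ _ _)
    rw [sum_congr rfl e, sum_range_flatMap F hF gs (h.pend ++ W)]
    refine sum_congr rfl fun k _ => sum_congr rfl fun j _ => hF _ ?_
    simp only [List.append_assoc]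
    exact List.Perm.append_left _ (List.perm_append_comm_assoc _ _ _)

/-- **One integration by parts in `gint` form** (`ibp_step` against `χ_D = (Π_{z∈D}∂_z)χ`): the head leg pairs with
another leg, goes to the source, to `χ′` (one more direction `Cu` at the end of `D`), or differentiates down a vertex.
[cite: BalabanImbrieJaffe1988, §5.14 p.311] -/
theorem gint_cons (hA : A.PosDef) (hχ : ∀ D : List (S → ℝ), ContDiff ℝ 1 (dlist D χ))
    (h0 : ∀ D : List (S → ℝ), ∃ K, ∀ φ, ‖dlist D χ φ * vexp c legs φ‖ ≤ K) (u : S → ℝ) (R D : List (S → ℝ)) :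
    gint A f χ c legs (u :: R) D
      = (∑ i ∈ range R.length, ((A⁻¹ *ᵥ u) ⬝ᵥ R.getD i 0) * gint A f χ c legs (R.eraseIdx i) D)
        + ((A⁻¹ *ᵥ u) ⬝ᵥ f) * gint A f χ c legs R D
        + gint A f χ c legs R (D ++ [A⁻¹ *ᵥ u])
        + ∑ m, ∑ j ∈ range (legs m).length, (-(c m * ((A⁻¹ *ᵥ u) ⬝ᵥ (legs m).getD j 0))) *
            gint A f χ c legs (R ++ (legs m).eraseIdx j) D := by
  obtain ⟨K₀, hK₀⟩ := h0 D
  obtain ⟨K₁, hK₁⟩ := h0 (D ++ [A⁻¹ *ᵥ u])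
  have hK₁' : ∀ φ, ‖fderiv ℝ (dlist D χ) φ (A⁻¹ *ᵥ u) * vexp c legs φ‖ ≤ K₁ := fun φ => by
    have h := hK₁ φ
    rwa [dlist_append_singleton] at h
  simp only [gint, dlist_append_singleton]
  exact ibp_step A hA f c legs (hχ D) hK₀ u hK₁' R

/-- **The value of a term** given the `χ′`-directions `D` already present: its coefficient times the Gaussian integral
of its components' pending legs against `(Π_{z ∈ D ++ dirs}∂_z)χ · e^{−V}`. [cite: BalabanImbrieJaffe1988, §5.14 p.311–312] -/
def cval (D : List (S → ℝ)) (t : CTerm S) : ℝ :=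
  t.coef * gint A f χ c legs (t.groups.flatMap Grp.pend) (D ++ t.dirs)

omit [DecidableEq S] in
/-- Total value of scaled terms. [cite: BalabanImbrieJaffe1988, §5.14 p.311] -/
theorem sum_cval_scale (D : List (S → ℝ)) (a : ℝ) : ∀ ts : List (CTerm S),
    ((ts.map (CTerm.scale a)).map (cval A f χ c legs D)).sum = a * (ts.map (cval A f χ c legs D)).sum
  | [] => by simp
  | t :: ts => by
    simp only [List.map_cons, List.sum_cons, sum_cval_scale D a ts, mul_add, cval, CTerm.scale_coef,
      CTerm.scale_groups, CTerm.scale_dirs, mul_assoc]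

omit [DecidableEq S] in
/-- Total value of terms with an earlier `χ′`-direction recorded. [cite: BalabanImbrieJaffe1988, §5.14 p.311] -/
theorem sum_cval_push (D : List (S → ℝ)) (z : S → ℝ) : ∀ ts : List (CTerm S),
    ((ts.map (CTerm.push z)).map (cval A f χ c legs D)).sum = (ts.map (cval A f χ c legs (D ++ [z]))).sum
  | [] => by simp
  | t :: ts => by
    simp only [List.map_cons, List.sum_cons, sum_cval_push D z ts, cval, CTerm.push_coef, CTerm.push_groups,
      CTerm.push_dirs, List.append_assoc, List.singleton_append]

omit [DecidableEq S] in
/-- Total value of scaled terms with one more vertex recorded. [cite: BalabanImbrieJaffe1988, §5.14 p.311] -/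
theorem sum_cval_scale_bump (D : List (S → ℝ)) (a : ℝ) : ∀ ts : List (CTerm S),
    ((ts.map fun t => (t.scale a).bump).map (cval A f χ c legs D)).sum = a * (ts.map (cval A f χ c legs D)).sum
  | [] => by simp
  | t :: ts => by
    simp only [List.map_cons, List.sum_cons, sum_cval_scale_bump D a ts, mul_add, cval, CTerm.bump_coef,
      CTerm.scale_coef, CTerm.bump_groups, CTerm.scale_groups, CTerm.bump_dirs, CTerm.scale_dirs, mul_assoc]

omit [Fintype S] [DecidableEq S] [Fintype ι] in
/-- Sums over a `flatMap` are iterated sums. [folklore] -/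
private theorem sum_map_flatMap {α β : Type} (l : List α) (g : α → List β) (h : β → ℝ) :
    ((l.flatMap g).map h).sum = (l.map fun a => ((g a).map h).sum).sum := by
  induction l with
  | nil => simp
  | cons a l ih => simp [List.flatMap_cons, List.map_append, List.sum_append, ih]

variable {A f χ c legs}

/-- **THE IDENTITY OF THE COMPONENT EXPANSION** — nothing is lost: for complete `done`, arbitrary `todo` and any
`χ′`-directions `D` already present,
`∫ Π_{all pending legs}Φ · (Π_{z∈D}∂_z)χ · e^{−V} dμ = Σ_{t ∈ cterms done todo} coef_t · ∫ Π_{legs of t's components}Φ · (Π_{z ∈ D ++ dirs_t}∂_z)χ · e^{−V} dμ`.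
Hypotheses: `A` positive definite; every iterated directional derivative `(Π∂_z)χ` is `C¹` with `((Π∂_z)χ)·e^{−V}`
bounded (e.g. `χ` smooth with compact support). [cite: BalabanImbrieJaffe1988, §5.14 p.311–312] -/
theorem cexpansion (hA : A.PosDef) (hχ : ∀ D : List (S → ℝ), ContDiff ℝ 1 (dlist D χ))
    (h0 : ∀ D : List (S → ℝ), ∃ K, ∀ φ, ‖dlist D χ φ * vexp c legs φ‖ ≤ K) (M : ℕ) :
    ∀ (n : ℕ) (done todo : List (Grp S)), pot M (maxArity legs) done todo < n → ∀ D : List (S → ℝ),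
      gint A f χ c legs (canon done todo) D
        = ((cterms A f c legs M done todo).map (cval A f χ c legs D)).sum
  | 0, _, _, hn => absurd hn (Nat.not_lt_zero _)
  | n + 1, done, [], _ => fun D => by
    rw [cterms]
    simp [cval, canon]
  | n + 1, done, g :: rest, hn => fun D => by
    have hn' : pot M (maxArity legs) done (g :: rest) ≤ n := Nat.lt_succ_iff.1 hn
    have IH : ∀ done' todo', pot M (maxArity legs) done' todo' < pot M (maxArity legs) done (g :: rest) →
        ∀ D' : List (S → ℝ), gint A f χ c legs (canon done' todo') D'
          = ((cterms A f c legs M done' todo').map (cval A f χ c legs D')).sum :=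
      fun done' todo' hlt D' => cexpansion hA hχ h0 M n done' todo' (lt_of_lt_of_le hlt hn') D'
    rw [cterms]
    split
    · -- the head component is complete: set aside (the legs are only reordered)
      rw [← IH _ _ (pot_move _ _ _ _ _) D]
      refine gint_perm A f χ c legs ?_ D
      simp only [canon, List.flatMap_cons, List.flatMap_append, List.flatMap_nil, List.append_nil]
      exact (List.perm_append_comm.append_right _).trans
        (by rw [List.append_assoc]; exact List.Perm.append_left _ List.perm_append_comm)
    · rename_i hc
      split
      · exact absurd ‹g.pend = []› (Grp.pend_ne_nil_of_not_complete hc)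
      · rename_i u L hp
        have hnv : g.nv < M := Grp.nv_lt_of_not_complete hc
        set Q := rest.flatMap Grp.pend ++ done.flatMap Grp.pend with hQ
        have hcanon : canon done (g :: rest) = u :: (L ++ Q) := by
          simp only [canon, List.flatMap_cons, hp, List.cons_append, List.append_assoc, hQ]
        -- permutation invariance of the summands used in the splittings below
        have hF₂ : ∀ x {P P' : List (S → ℝ)}, P.Perm P' →
            ((A⁻¹ *ᵥ u) ⬝ᵥ x) * gint A f χ c legs (L ++ P) D = ((A⁻¹ *ᵥ u) ⬝ᵥ x) * gint A f χ c legs (L ++ P') D :=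
          fun x P P' h => by rw [gint_perm A f χ c legs (h.append_left L) D]
        have hF₃ : ∀ x {P P' : List (S → ℝ)}, P.Perm P' →
            ((A⁻¹ *ᵥ u) ⬝ᵥ x) * gint A f χ c legs (L ++ (rest.flatMap Grp.pend ++ P)) D
              = ((A⁻¹ *ᵥ u) ⬝ᵥ x) * gint A f χ c legs (L ++ (rest.flatMap Grp.pend ++ P')) D :=
          fun x P P' h => by rw [gint_perm A f χ c legs ((h.append_left _).append_left L) D]
        -- THE LEFT-HAND SIDE: one integration by parts of the head leg, the pairing sum split by component
        have hL1 := sum_range_append L Q 0 (fun x P => ((A⁻¹ *ᵥ u) ⬝ᵥ x) * gint A f χ c legs P D)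
        have hL2 := sum_range_append (rest.flatMap Grp.pend) (done.flatMap Grp.pend) 0
          (fun x P => ((A⁻¹ *ᵥ u) ⬝ᵥ x) * gint A f χ c legs (L ++ P) D)
        have hL3 := sum_range_flatMap (fun x P => ((A⁻¹ *ᵥ u) ⬝ᵥ x) * gint A f χ c legs (L ++ P) D) hF₂ rest
          (done.flatMap Grp.pend)
        have hL4 := sum_range_flatMap
          (fun x P => ((A⁻¹ *ᵥ u) ⬝ᵥ x) * gint A f χ c legs (L ++ (rest.flatMap Grp.pend ++ P)) D) hF₃ done []
        simp only [List.append_nil] at hL4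
        rw [hcanon, gint_cons A f χ c legs hA hχ h0 u (L ++ Q) D, hL1, hQ, hL2, hL3, hL4]
        -- THE RIGHT-HAND SIDE: the six groups of terms, each by the induction hypothesis
        have e1 : ∀ i ∈ range L.length,
            (((cterms A f c legs M done (⟨L.eraseIdx i, g.nchi, g.nv⟩ :: rest)).map
                (CTerm.scale ((A⁻¹ *ᵥ u) ⬝ᵥ L.getD i 0))).map (cval A f χ c legs D)).sum
              = ((A⁻¹ *ᵥ u) ⬝ᵥ L.getD i 0) *
                gint A f χ c legs (L.eraseIdx i ++ (rest.flatMap Grp.pend ++ done.flatMap Grp.pend)) D :=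
          fun i _ => by
            rw [sum_cval_scale, ← IH _ _ (pot_head_lt M (maxArity legs) done rest (g := g)
              (g' := ⟨L.eraseIdx i, g.nchi, g.nv⟩) rfl
              (by simp only [hp, List.length_cons]; have := List.length_eraseIdx_le L i; omega)) D]
            simp only [canon, List.flatMap_cons, List.append_assoc]
        have e2 : ∀ k ∈ range rest.length, ∀ j ∈ range (rest.getD k default).pend.length,
            (((cterms A f c legs M done (Grp.merge L g (rest.getD k default) j :: rest.eraseIdx k)).map
                (CTerm.scale ((A⁻¹ *ᵥ u) ⬝ᵥ (rest.getD k default).pend.getD j 0))).map (cval A f χ c legs D)).sum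
              = ((A⁻¹ *ᵥ u) ⬝ᵥ (rest.getD k default).pend.getD j 0) *
                gint A f χ c legs (L ++ ((rest.getD k default).pend.eraseIdx j ++
                  ((rest.eraseIdx k).flatMap Grp.pend ++ done.flatMap Grp.pend))) D :=
          fun k hk j _ => by
            rw [sum_cval_scale, ← IH _ _ (pot_merge_rest _ _ _ _ _ hp (mem_range.1 hk) _) D]
            simp only [canon, Grp.merge, List.flatMap_cons, List.append_assoc]
        have e3 : ∀ k ∈ range done.length, ∀ j ∈ range (done.getD k default).pend.length,
            (((cterms A f c legs M (done.eraseIdx k) (Grp.merge L g (done.getD k default) j :: rest)).map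
                (CTerm.scale ((A⁻¹ *ᵥ u) ⬝ᵥ (done.getD k default).pend.getD j 0))).map (cval A f χ c legs D)).sum
              = ((A⁻¹ *ᵥ u) ⬝ᵥ (done.getD k default).pend.getD j 0) *
                gint A f χ c legs (L ++ (rest.flatMap Grp.pend ++ ((done.getD k default).pend.eraseIdx j ++
                  (done.eraseIdx k).flatMap Grp.pend))) D :=
          fun k hk j _ => by
            rw [sum_cval_scale, ← IH _ _ (pot_merge_done _ _ _ _ _ hp (mem_range.1 hk) _) D]
            congr 1
            refine gint_perm A f χ c legs ?_ D
            simp only [canon, Grp.merge, List.flatMap_cons, List.append_assoc]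
            exact List.Perm.append_left L (List.perm_append_comm_assoc _ _ _)
        have e4 : (((cterms A f c legs M done (⟨L, g.nchi, g.nv⟩ :: rest)).map
                (CTerm.scale ((A⁻¹ *ᵥ u) ⬝ᵥ f))).map (cval A f χ c legs D)).sum
              = ((A⁻¹ *ᵥ u) ⬝ᵥ f) * gint A f χ c legs (L ++ (rest.flatMap Grp.pend ++ done.flatMap Grp.pend)) D := by
          rw [sum_cval_scale, ← IH _ _ (pot_head_lt M (maxArity legs) done rest (g := g) (g' := ⟨L, g.nchi, g.nv⟩)
            rfl (by simp only [hp, List.length_cons]; omega)) D]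
          simp only [canon, List.flatMap_cons, List.append_assoc]
        have e5 : (((cterms A f c legs M done (⟨L, g.nchi + 1, g.nv⟩ :: rest)).map
                (CTerm.push (A⁻¹ *ᵥ u))).map (cval A f χ c legs D)).sum
              = gint A f χ c legs (L ++ (rest.flatMap Grp.pend ++ done.flatMap Grp.pend)) (D ++ [A⁻¹ *ᵥ u]) := by
          rw [sum_cval_push, ← IH _ _ (pot_head_lt M (maxArity legs) done rest (g := g)
            (g' := ⟨L, g.nchi + 1, g.nv⟩) rfl (by simp only [hp, List.length_cons]; omega)) (D ++ [A⁻¹ *ᵥ u])]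
          simp only [canon, List.flatMap_cons, List.append_assoc]
        have e6 : ∀ m ∈ (univ : Finset ι), ∀ j ∈ range (legs m).length,
            (((cterms A f c legs M done (⟨L ++ (legs m).eraseIdx j, g.nchi, g.nv + 1⟩ :: rest)).map
                fun t => (t.scale (-(c m * ((A⁻¹ *ᵥ u) ⬝ᵥ (legs m).getD j 0)))).bump).map (cval A f χ c legs D)).sum
              = (-(c m * ((A⁻¹ *ᵥ u) ⬝ᵥ (legs m).getD j 0))) *
                gint A f χ c legs (L ++ (rest.flatMap Grp.pend ++ done.flatMap Grp.pend) ++ (legs m).eraseIdx j) D :=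
          fun m _ j _ => by
            rw [sum_cval_scale_bump, ← IH _ _ (pot_vertex M legs done rest g hp hnv m j) D]
            congr 1
            refine gint_perm A f χ c legs ?_ D
            simp only [canon, List.flatMap_cons, List.append_assoc]
            exact List.Perm.append_left L (List.perm_append_comm.trans (by rw [List.append_assoc]))
        simp only [List.map_append, List.sum_append, sum_map_flatMap, Finset.sum_map_toList]
        rw [sum_congr rfl e1, e4, e5, sum_congr rfl fun m hm => sum_congr rfl (e6 m hm)]
        have e2' : ∀ k ∈ range rest.length,
            ((if _hk : k < rest.length then
                (range (rest.getD k default).pend.length).toList.flatMap fun j =>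
                  (cterms A f c legs M done (Grp.merge L g (rest.getD k default) j :: rest.eraseIdx k)).map
                    (CTerm.scale ((A⁻¹ *ᵥ u) ⬝ᵥ (rest.getD k default).pend.getD j 0))
              else []).map (cval A f χ c legs D)).sum
              = ∑ j ∈ range (rest.getD k default).pend.length, ((A⁻¹ *ᵥ u) ⬝ᵥ (rest.getD k default).pend.getD j 0) *
                gint A f χ c legs (L ++ ((rest.getD k default).pend.eraseIdx j ++
                  ((rest.eraseIdx k).flatMap Grp.pend ++ done.flatMap Grp.pend))) D := fun k hk => by
          rw [dif_pos (mem_range.1 hk), sum_map_flatMap, Finset.sum_map_toList]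
          exact sum_congr rfl (e2 k hk)
        have e3' : ∀ k ∈ range done.length,
            ((if _hk : k < done.length then
                (range (done.getD k default).pend.length).toList.flatMap fun j =>
                  (cterms A f c legs M (done.eraseIdx k) (Grp.merge L g (done.getD k default) j :: rest)).map
                    (CTerm.scale ((A⁻¹ *ᵥ u) ⬝ᵥ (done.getD k default).pend.getD j 0))
              else []).map (cval A f χ c legs D)).sum
              = ∑ j ∈ range (done.getD k default).pend.length, ((A⁻¹ *ᵥ u) ⬝ᵥ (done.getD k default).pend.getD j 0) *
                gint A f χ c legs (L ++ (rest.flatMap Grp.pend ++ ((done.getD k default).pend.eraseIdx j ++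
                  (done.eraseIdx k).flatMap Grp.pend))) D := fun k hk => by
          rw [dif_pos (mem_range.1 hk), sum_map_flatMap, Finset.sum_map_toList]
          exact sum_congr rfl (e3 k hk)
        rw [sum_congr rfl e2', sum_congr rfl e3']
        simp only [List.append_assoc]
        ring

omit [Fintype S] [DecidableEq S] in
/-- The pending legs of the initial state are all the legs of the observables. [cite: BalabanImbrieJaffe1988, §5.14 p.311] -/
theorem canon_init (obs : List (List (S → ℝ))) : canon [] (initGrps obs) = obs.flatten := by
  induction obs with
  | nil => rfl
  | cons L obs ih =>
    simp only [canon, initGrps, List.map_cons, List.flatMap_cons, List.flatMap_nil, List.append_nil,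
      List.flatten_cons] at ih ⊢
    rw [ih]

/-- **THE INTEGRATION BY PARTS OF A PRODUCT OF OBSERVABLES, COMPONENT BY COMPONENT** (p. 311–312, print's rule
verbatim): for observables given by their leg lists `obs` (one initial component each), in the Gaussian measure with
weight `χe^{−V}`:
`∫ Π_{all legs}Φ · χe^{−V} dμ = Σ_{t ∈ cterms [] (initGrps obs)} coef_t · ∫ Π_{legs of t's components}Φ · (Π_{z∈dirs_t}∂_z)χ · e^{−V} dμ`,
every component of every term being complete (`cterms_init_sound`): constant (all legs contracted, no `χ′`, `≤ m̄`
vertices) or remainder (a `χ′` or `≥ m̄+1` vertices). [cite: BalabanImbrieJaffe1988, §5.14 p.311–312] -/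
theorem cexpansion_init (hA : A.PosDef) (hχ : ∀ D : List (S → ℝ), ContDiff ℝ 1 (dlist D χ))
    (h0 : ∀ D : List (S → ℝ), ∃ K, ∀ φ, ‖dlist D χ φ * vexp c legs φ‖ ≤ K) (M : ℕ)
    (obs : List (List (S → ℝ))) :
    ∫ φ : S → ℝ, lmono obs.flatten φ * (χ φ * vexp c legs φ) * (weight A φ * source f φ)
      = ((cterms A f c legs M [] (initGrps obs)).map fun t =>
          t.coef * gint A f χ c legs (t.groups.flatMap Grp.pend) t.dirs).sum := by
  have h := cexpansion (f := f) hA hχ h0 M _ [] (initGrps obs) (Nat.lt_succ_self _) []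
  rw [canon_init] at h
  simp only [gint, dlist_nil] at h ⊢
  exact h

end Identity


/-! ## §4  The small factor per vertex: coefficient bound -/

omit [Fintype S] [Fintype ι] [DecidableEq S] in
/-- One contraction weight times a bounded coefficient. [folklore] -/
private theorem abs_mul_le_step {a x B Mx y : ℝ} {N' N : ℕ} (ha : |a| ≤ B) (hBM : B ≤ Mx) (hM : 1 ≤ Mx)
    (hy : 0 ≤ y) (hx : |x| ≤ Mx ^ N' * y) (hN : N' + 1 ≤ N) : |a * x| ≤ Mx ^ N * y := by
  have hX : 0 ≤ Mx ^ N' * y := mul_nonneg (pow_nonneg (zero_le_one.trans hM) _) hy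
  rw [abs_mul]
  calc |a| * |x| ≤ B * (Mx ^ N' * y) := mul_le_mul ha hx (abs_nonneg _) ((abs_nonneg a).trans ha)
    _ ≤ Mx * (Mx ^ N' * y) := mul_le_mul_of_nonneg_right hBM hX
    _ = Mx ^ (N' + 1) * y := by ring
    _ ≤ Mx ^ N * y := mul_le_mul_of_nonneg_right (pow_le_pow_right₀ hM hN) hy

omit [Fintype S] [Fintype ι] [DecidableEq S] in
/-- An in-range default access is a member. [folklore] -/
private theorem getD_mem {Dir : Set (S → ℝ)} {L : List (S → ℝ)} (hL : ∀ w ∈ L, w ∈ Dir) {i : ℕ}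
    (hi : i < L.length) : L.getD i 0 ∈ Dir := by
  rw [List.getD_eq_getElem _ _ hi]
  exact hL _ (List.getElem_mem hi)

/-- **EACH DIFFERENTIATED-DOWN VERTEX CONTRIBUTES ONE COUPLING CONSTANT** (all components): with covariance brackets
bounded by `B` on a set `Dir` containing every pending leg and every vertex leg, `0 ≤ c_M`, `|c_m| ≤ c_M`: every term
of `cterms done todo` has `|coef| ≤ (max B 1)^{pot done todo} · c_M^{nv}` (`nv` = the vertices differentiated down in
its history = `Σ_components nv − Σ_initial nv` by `cterms_sound`; every step of the expansion lowers `pot`, which thus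
bounds the number of contraction weights). [cite: BalabanImbrieJaffe1988, §5.14 p.312] -/
theorem ccoef_bound (A : Matrix S S ℝ) (f : S → ℝ) (c : ι → ℝ) (legs : ι → List (S → ℝ)) (M : ℕ)
    {Dir : Set (S → ℝ)} {B cM : ℝ} (hB : ∀ u ∈ Dir, ∀ v ∈ Dir, |(A⁻¹ *ᵥ u) ⬝ᵥ v| ≤ B)
    (hBf : ∀ u ∈ Dir, |(A⁻¹ *ᵥ u) ⬝ᵥ f| ≤ B) (hcM : 0 ≤ cM) (hcm : ∀ m, |c m| ≤ cM)
    (hlegs : ∀ m, ∀ w ∈ legs m, w ∈ Dir) :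
    ∀ (n : ℕ) (done todo : List (Grp S)), pot M (maxArity legs) done todo < n →
      (∀ g ∈ done ++ todo, ∀ w ∈ g.pend, w ∈ Dir) → ∀ t ∈ cterms A f c legs M done todo,
        |t.coef| ≤ (max B 1) ^ pot M (maxArity legs) done todo * cM ^ t.nv
  | 0, _, _, hn, _ => fun _ _ => absurd hn (Nat.not_lt_zero _)
  | n + 1, done, [], _, _ => by
    intro t ht
    rw [cterms, List.mem_singleton] at ht
    subst ht
    simp only [abs_one, pow_zero, mul_one]
    exact one_le_pow₀ (le_max_right B 1)
  | n + 1, done, g :: rest, hn, hDir => by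
    intro t ht
    have hM : 1 ≤ max B 1 := le_max_right B 1
    have hBM : B ≤ max B 1 := le_max_left B 1
    have hn' : pot M (maxArity legs) done (g :: rest) ≤ n := Nat.lt_succ_iff.1 hn
    have IH : ∀ done' todo', pot M (maxArity legs) done' todo' < pot M (maxArity legs) done (g :: rest) →
        (∀ g ∈ done' ++ todo', ∀ w ∈ g.pend, w ∈ Dir) → ∀ t ∈ cterms A f c legs M done' todo',
          |t.coef| ≤ (max B 1) ^ pot M (maxArity legs) done' todo' * cM ^ t.nv :=
      fun done' todo' hlt hd' => ccoef_bound A f c legs M hB hBf hcM hcm hlegs n done' todo' (lt_of_lt_of_le hlt hn') hd'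
    -- from a bound at a smaller potential to the bound at this one
    have lift : ∀ {x : ℝ} {N' k : ℕ}, |x| ≤ (max B 1) ^ N' * cM ^ k → N' < pot M (maxArity legs) done (g :: rest) →
        |x| ≤ (max B 1) ^ pot M (maxArity legs) done (g :: rest) * cM ^ k := fun hx hlt =>
      hx.trans (mul_le_mul_of_nonneg_right (pow_le_pow_right₀ hM hlt.le) (pow_nonneg hcM _))
    have hg : ∀ w ∈ g.pend, w ∈ Dir := hDir g (List.mem_append_right _ List.mem_cons_self)
    have hdone : ∀ h ∈ done, ∀ w ∈ h.pend, w ∈ Dir := fun h hh => hDir h (List.mem_append_left _ hh)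
    have hrest : ∀ h ∈ rest, ∀ w ∈ h.pend, w ∈ Dir := fun h hh =>
      hDir h (List.mem_append_right _ (List.mem_cons_of_mem g hh))
    -- Dir-closure of a new state from its parts
    have mk : ∀ (done' rest' : List (Grp S)) (g' : Grp S), (∀ h ∈ done', ∀ w ∈ h.pend, w ∈ Dir) →
        (∀ w ∈ g'.pend, w ∈ Dir) → (∀ h ∈ rest', ∀ w ∈ h.pend, w ∈ Dir) →
        ∀ h ∈ done' ++ g' :: rest', ∀ w ∈ h.pend, w ∈ Dir := fun done' rest' g' h1 h2 h3 h hh => by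
      rcases List.mem_append.1 hh with hh | hh
      · exact h1 h hh
      · rcases List.mem_cons.1 hh with rfl | hh
        · exact h2
        · exact h3 h hh
    rw [cterms] at ht
    split at ht
    · refine lift (IH _ _ (pot_move _ _ _ _ _) (fun h hh => ?_) t ht) (pot_move _ _ _ _ _)
      rcases List.mem_append.1 hh with hh | hh
      · rcases List.mem_append.1 hh with hh | hh
        · exact hdone h hh
        · rw [List.mem_singleton.1 hh]; exact hg
      · exact hrest h hh
    · rename_i hc
      split at ht
      · exact absurd ‹g.pend = []› (Grp.pend_ne_nil_of_not_complete hc)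
      · rename_i u L hp
        have hnv : g.nv < M := Grp.nv_lt_of_not_complete hc
        have hu : u ∈ Dir := hg u (by rw [hp]; exact List.mem_cons_self)
        have hL : ∀ w ∈ L, w ∈ Dir := fun w hw => hg w (by rw [hp]; exact List.mem_cons_of_mem u hw)
        simp only [List.mem_append, List.mem_flatMap, List.mem_map, Finset.mem_toList, Finset.mem_range,
          Finset.mem_univ, true_and] at ht
        rcases ht with (((((⟨i, hi, t', ht', rfl⟩ | ⟨k, hk, hmem⟩) | ⟨k, hk, hmem⟩) | ⟨t', ht', rfl⟩) | ⟨t', ht', rfl⟩) |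
          ⟨m, j, hj, t', ht', rfl⟩)
        · -- (1)
          have hlt := pot_head_lt M (maxArity legs) done rest (g := g) (g' := ⟨L.eraseIdx i, g.nchi, g.nv⟩) rfl
            (by simp only [hp, List.length_cons]; have := List.length_eraseIdx_le L i; omega)
          have h' := IH _ _ hlt (mk _ _ _ hdone (fun w hw => hL w (List.mem_of_mem_eraseIdx hw)) hrest) t' ht'
          rw [CTerm.scale_coef, CTerm.scale_nv]
          exact abs_mul_le_step (hB u hu _ (getD_mem hL hi)) hBM hM (pow_nonneg hcM _) h' hlt
        · -- (2)
          rw [dif_pos hk] at hmem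
          simp only [List.mem_flatMap, List.mem_map, Finset.mem_toList, Finset.mem_range] at hmem
          obtain ⟨j, hj, t', ht', rfl⟩ := hmem
          have hh : ∀ w ∈ (rest.getD k default).pend, w ∈ Dir :=
            hrest _ (by rw [List.getD_eq_getElem _ _ hk]; exact List.getElem_mem hk)
          have hlt := pot_merge_rest M (maxArity legs) done rest g hp hk j
          have h' := IH _ _ hlt (mk _ _ _ hdone (fun w hw => by
              rcases List.mem_append.1 hw with hw | hw
              · exact hL w hw
              · exact hh w (List.mem_of_mem_eraseIdx hw))
            (fun h hh' => hrest h (List.mem_of_mem_eraseIdx hh'))) t' ht'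
          rw [CTerm.scale_coef, CTerm.scale_nv]
          exact abs_mul_le_step (hB u hu _ (getD_mem hh hj)) hBM hM (pow_nonneg hcM _) h' hlt
        · -- (3)
          rw [dif_pos hk] at hmem
          simp only [List.mem_flatMap, List.mem_map, Finset.mem_toList, Finset.mem_range] at hmem
          obtain ⟨j, hj, t', ht', rfl⟩ := hmem
          have hh : ∀ w ∈ (done.getD k default).pend, w ∈ Dir :=
            hdone _ (by rw [List.getD_eq_getElem _ _ hk]; exact List.getElem_mem hk)
          have hlt := pot_merge_done M (maxArity legs) done rest g hp hk j
          have h' := IH _ _ hlt (mk _ _ _ (fun h hh' => hdone h (List.mem_of_mem_eraseIdx hh')) (fun w hw => by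
              rcases List.mem_append.1 hw with hw | hw
              · exact hL w hw
              · exact hh w (List.mem_of_mem_eraseIdx hw)) hrest) t' ht'
          rw [CTerm.scale_coef, CTerm.scale_nv]
          exact abs_mul_le_step (hB u hu _ (getD_mem hh hj)) hBM hM (pow_nonneg hcM _) h' hlt
        · -- (4)
          have hlt := pot_head_lt M (maxArity legs) done rest (g := g) (g' := ⟨L, g.nchi, g.nv⟩) rfl
            (by simp only [hp, List.length_cons]; omega)
          have h' := IH _ _ hlt (mk _ _ _ hdone hL hrest) t' ht'
          rw [CTerm.scale_coef, CTerm.scale_nv]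
          exact abs_mul_le_step (hBf u hu) hBM hM (pow_nonneg hcM _) h' hlt
        · -- (5)
          have hlt := pot_head_lt M (maxArity legs) done rest (g := g) (g' := ⟨L, g.nchi + 1, g.nv⟩) rfl
            (by simp only [hp, List.length_cons]; omega)
          have h' := IH _ _ hlt (mk _ _ _ hdone hL hrest) t' ht'
          rw [CTerm.push_coef, CTerm.push_nv]
          exact lift h' hlt
        · -- (6)
          have hlt := pot_vertex M legs done rest g hp hnv m j
          have h' := IH _ _ hlt (mk _ _ _ hdone (fun w hw => by
              rcases List.mem_append.1 hw with hw | hw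
              · exact hL w hw
              · exact hlegs m w (List.mem_of_mem_eraseIdx hw)) hrest) t' ht'
          have ha : |(A⁻¹ *ᵥ u) ⬝ᵥ (legs m).getD j 0| ≤ B := hB u hu _ (getD_mem (hlegs m) hj)
          rw [CTerm.bump_coef, CTerm.scale_coef, CTerm.bump_nv, CTerm.scale_nv, pow_succ, ← mul_assoc, neg_mul,
            abs_neg, mul_assoc, abs_mul]
          have hstep : |(A⁻¹ *ᵥ u) ⬝ᵥ (legs m).getD j 0 * t'.coef|
              ≤ (max B 1) ^ pot M (maxArity legs) done (g :: rest) * cM ^ t'.nv :=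
            abs_mul_le_step ha hBM hM (pow_nonneg hcM _) h' hlt
          calc |c m| * |(A⁻¹ *ᵥ u) ⬝ᵥ (legs m).getD j 0 * t'.coef|
              ≤ cM * ((max B 1) ^ pot M (maxArity legs) done (g :: rest) * cM ^ t'.nv) :=
                mul_le_mul (hcm m) hstep (abs_nonneg _) hcM
            _ = (max B 1) ^ pot M (maxArity legs) done (g :: rest) * cM ^ t'.nv * cM := by ring


end Literature.MathematicalPhysics.QuantumFieldTheory.BalabanImbrieJaffe1984to88.BIJ88VertexComponentsExpansion311
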